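import Summits.QuantumFields.GaugeBoot.ZdWordFreeReduction
import Summits.QuantumFields.GaugeBoot.HaarShiftSupport
import Summits.QuantumFields.GaugeBoot.ClassBHaarShift
import Summits.QuantumFields.GaugeBoot.WordLoopZdLimit
import HarnessLib

/-!
# No Wilson loop is frozen in infinite volume: `⟨W_x(w)⟩_μ < 1` for every DLR state, every Class-B state and every thermodynamic limit point, at every coupling (gauge-boot, large-`N` supplement 16, part 11)

HONEST FRAMING (cell `pub-gaugeboot`, page 1 of every file): the venture produces certified bounds
on lattice expectations at stated coupling, gauge group, dimension and torus size; NOT a mass gap,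
NOT a continuum limit, NOT a string tension; NOT large `N` unless marked CONDITIONAL; NOT
Yang–Mills-summit-bearing (barriers `FixedCouplingUltralocality`, `PerturbativeInvisibility`).
A qualitative STRICT inequality for the states the lattice bootstrap quantifies over; it certifies no number.

## Content

Part 10 proved `⟨W⟩_{β,L} < 1` on every finite torus.  The infinite-volume version follows from two lane
facts: the free configuration of part 2 (a point where `1 − W > 0`) and the FULL SUPPORT of Haar-shift
states on cylinder sets (`HaarShiftSupport.lean`: `IsHaarShiftState.integral_pos_of_pos` — a non-negative
continuous cylinder observable positive at one configuration has positive mean in every Haar-shift state).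

* `isCylinder_one_sub_wordLoopZd`, `wordLoopZd_freeConfig_lt_one` (at the free configuration `W < 1` for
  every word with non-empty free reduction);
* ★★★ `IsHaarShiftState.integral_wordLoopZd_lt_one` — **`SU(N)`, `N ≥ 2`, ANY `d`, ANY real `β`, ANY
  probability measure on `LGConfig d (SU N)` with the one-link Haar-shift (= DLR) identity, any base point,
  any word whose free reduction is non-empty: `∫ W_x(w) dμ < 1` STRICTLY**; `…_eq_one_iff` (`= 1` iff the
  free reduction is empty); `…_gt_neg_one` (every word);
* ★★★ the same for every DLR state `μ ∈ ymGibbsMeasures (suRep N) β` (`integral_wordLoopZd_lt_one_of_mem_ymGibbsMeasures`),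
  every thermodynamic limit point of the torus Wilson states (`…_of_mem_infiniteVolumeLimitPoints`) and
  every Class-B state (`ClassBState.integral_wordLoopZd_lt_one`): the bound `y_v ≤ 1` of a Class-B / KZ
  certificate is NEVER attained by a state on a non-trivial loop variable, at any coupling, in any dimension.

NOT claimed: any rate or uniformity in `β`; `SO(N)`/`U(N)` spellings (the free pair exists there too, parts 6–7,
but the loop-variable dictionary `W = 1 ⟺ hol = 1` is typed for `SU(N)` only).  [folklore] (Georgii 2011
§1.2–2.1: DLR states are quasi-invariant under local modifications; the lane's `HaarShiftSupport`).
-/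

noncomputable section

open MeasureTheory
open Literature.Probability.LatticeModels (Site)
open Literature.MathematicalPhysics.QuantumLattice
open Literature.Probability.LatticeModels (IsGibbsMeasure)

namespace Summit.QuantumFields.GaugeBoot

variable {d N : ℕ}

/-! ## The observable `1 − W_x(w)` -/

/-- `W_x(w)` is a cylinder observable (the lane's `exists_isCylinder_wordLoopZd`), hence so is `1 − W_x(w)`. [folklore] -/
theorem isCylinder_one_sub_wordLoopZd {G : Type*} [Group G] (ρ : G →* Matrix (Fin N) (Fin N) ℂ) (x : Site d) (w : Word d) :
    ∃ S : Finset (ZdEdge d), IsCylinder (fun U : LGConfig d G => 1 - wordLoopZd ρ x w U) S := by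
  obtain ⟨S, hS⟩ := exists_isCylinder_wordLoopZd (G := G) ρ x w
  exact ⟨S, fun U V hUV => by simp only [hS hUV]⟩

/-- `1 + W_x(w)` is a cylinder observable. [folklore] -/
theorem isCylinder_one_add_wordLoopZd {G : Type*} [Group G] (ρ : G →* Matrix (Fin N) (Fin N) ℂ) (x : Site d) (w : Word d) :
    ∃ S : Finset (ZdEdge d), IsCylinder (fun U : LGConfig d G => 1 + wordLoopZd ρ x w U) S := by
  obtain ⟨S, hS⟩ := exists_isCylinder_wordLoopZd (G := G) ρ x w
  exact ⟨S, fun U V hUV => by simp only [hS hUV]⟩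

/-- **At the free configuration every word with non-empty free reduction has loop variable `< 1`** (`SU(2+k)`). [folklore] -/
theorem wordLoopZd_freeConfig_lt_one (k : ℕ) (x : Site d) {w : Word d} (hw : Word.freeReduce w ≠ []) :
    wordLoopZd (suRep (2 + k)) x w (freeConfig d k) < 1 := by
  rw [wordLoopZd_suRep_lt_one_iff (by omega), ← wordHolonomyZd_freeReduce (freeConfig d k) w x]
  exact wordHolonomyZd_freeConfig_ne_one k x hw (Word.isChain_freeReduce w)

/-! ## Haar-shift (= DLR) states: strict inequalities -/

section HaarShift

variable {β : ℝ} {μ : Measure (LGConfig d (SU N))}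

/-- ★★★ **NO WILSON LOOP IS FROZEN IN ANY HAAR-SHIFT STATE.**  `SU(N)`, `N ≥ 2`, any `d`, any real `β`, any
probability measure `μ` on `LGConfig d (SU N)` with the one-link Haar-shift identity (equivalently: any DLR
state), any base point, any word `w` whose free reduction is non-empty: `∫ W_x(w) dμ < 1` STRICTLY. [folklore] -/
theorem IsHaarShiftState.integral_wordLoopZd_lt_one (hN : 2 ≤ N) [IsProbabilityMeasure μ] (hμ : IsHaarShiftState (suRep N) β μ)
    (x : Site d) {w : Word d} (hw : Word.freeReduce w ≠ []) : ∫ U, wordLoopZd (suRep N) x w U ∂μ < 1 := by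
  obtain ⟨k, rfl⟩ := Nat.exists_eq_add_of_le hN
  haveI : SecondCountableTopology (Matrix (Fin (2 + k)) (Fin (2 + k)) ℂ) :=
    inferInstanceAs (SecondCountableTopology (Fin (2 + k) → Fin (2 + k) → ℂ))
  haveI : SecondCountableTopology (SU (2 + k)) := Topology.IsEmbedding.subtypeVal.secondCountableTopology
  obtain ⟨S, hS⟩ := isCylinder_one_sub_wordLoopZd (G := SU (2 + k)) (suRep (2 + k)) x w
  have hpos : 0 < ∫ U, (1 - wordLoopZd (suRep (2 + k)) x w U) ∂μ :=
    hμ.integral_pos_of_pos hS (continuous_const.sub (continuous_wordLoopZd (continuous_suRep (2 + k)) x w))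
      (fun U => sub_nonneg.2 ((le_abs_self _).trans (abs_wordLoopZd_le_one (suRep (2 + k)) (continuous_suRep (2 + k)) x w U)))
      (U₀ := freeConfig d k) (sub_pos.2 (wordLoopZd_freeConfig_lt_one k x hw))
  rw [integral_sub (integrable_const 1) (integrable_wordLoopZd (suRep (2 + k)) (continuous_suRep (2 + k)) μ x w), integral_const,
    smul_eq_mul, mul_one, probReal_univ] at hpos
  linarith

/-- **`∫ W_x(w) dμ > −1`** in every Haar-shift state, for every word (`N ≥ 1`; `1 + W` is positive at the
trivial configuration). [folklore] -/
theorem IsHaarShiftState.integral_wordLoopZd_gt_neg_one (hN : N ≠ 0) [IsProbabilityMeasure μ] (hμ : IsHaarShiftState (suRep N) β μ)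
    (x : Site d) (w : Word d) : -1 < ∫ U, wordLoopZd (suRep N) x w U ∂μ := by
  haveI : SecondCountableTopology (Matrix (Fin N) (Fin N) ℂ) := inferInstanceAs (SecondCountableTopology (Fin N → Fin N → ℂ))
  haveI : SecondCountableTopology (SU N) := Topology.IsEmbedding.subtypeVal.secondCountableTopology
  obtain ⟨S, hS⟩ := isCylinder_one_add_wordLoopZd (G := SU N) (suRep N) x w
  have h1 : wordLoopZd (suRep N) x w (fun _ => (1 : SU N)) = 1 := by
    rw [wordLoopZd_suRep_eq_one_iff hN]
    clear hμ hS
    induction w generalizing x with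
    | nil => rfl
    | cons s w ih => rw [wordHolonomyZd_cons, ih]; cases s <;> simp
  have hpos : 0 < ∫ U, (1 + wordLoopZd (suRep N) x w U) ∂μ :=
    hμ.integral_pos_of_pos hS (continuous_const.add (continuous_wordLoopZd (continuous_suRep N) x w))
      (fun U => by
        have := (abs_le.1 (abs_wordLoopZd_le_one (suRep N) (continuous_suRep N) x w U)).1
        linarith)
      (U₀ := fun _ => (1 : SU N)) (by rw [h1]; norm_num)
  rw [integral_add (integrable_const 1) (integrable_wordLoopZd (suRep N) (continuous_suRep N) μ x w), integral_const,
    smul_eq_mul, mul_one, probReal_univ] at hpos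
  linarith

/-- ★★★ **`∫ W_x(w) dμ = 1` iff the word freely reduces to the empty word** (Haar-shift state, `SU(N)`, `N ≥ 2`).
[folklore] -/
theorem IsHaarShiftState.integral_wordLoopZd_eq_one_iff (hN : 2 ≤ N) [IsProbabilityMeasure μ] (hμ : IsHaarShiftState (suRep N) β μ)
    (x : Site d) (w : Word d) : ∫ U, wordLoopZd (suRep N) x w U ∂μ = 1 ↔ Word.freeReduce w = [] := by
  refine ⟨fun h => ?_, fun h => ?_⟩
  · by_contra hw
    exact (hμ.integral_wordLoopZd_lt_one hN x hw).ne h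
  · have hW : wordLoopZd (suRep N) x w = fun _ => (1 : ℝ) := by
      funext U
      rw [← wordLoopZd_freeReduce (suRep N) x w, h, wordLoopZd_suRep_eq_one_iff (by omega), wordHolonomyZd_nil]
    rw [hW, integral_const, smul_eq_mul, mul_one, probReal_univ]

/-- Hence `|∫ W_x(w) dμ| < 1` for every word with non-empty free reduction (Haar-shift state, `N ≥ 2`). [folklore] -/
theorem IsHaarShiftState.abs_integral_wordLoopZd_lt_one (hN : 2 ≤ N) [IsProbabilityMeasure μ] (hμ : IsHaarShiftState (suRep N) β μ)
    (x : Site d) {w : Word d} (hw : Word.freeReduce w ≠ []) : |∫ U, wordLoopZd (suRep N) x w U ∂μ| < 1 :=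
  abs_lt.2 ⟨hμ.integral_wordLoopZd_gt_neg_one (by omega) x w, hμ.integral_wordLoopZd_lt_one hN x hw⟩

end HaarShift

/-! ## DLR states, thermodynamic limit points, Class-B states -/

/-- ★★★ **Every infinite-volume DLR state**: `μ ∈ 𝒢(β)` of `SU(N)` lattice gauge theory (`N ≥ 2`, any `d`, any
real `β`), any word with non-empty free reduction: `∫ W_x(w) dμ < 1`. [folklore] -/
theorem integral_wordLoopZd_lt_one_of_mem_ymGibbsMeasures (hN : 2 ≤ N) {β : ℝ} {μ : Measure (LGConfig d (SU N))}
    (hμ : μ ∈ ymGibbsMeasures (suRep N) β) (x : Site d) {w : Word d} (hw : Word.freeReduce w ≠ []) :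
    ∫ U, wordLoopZd (suRep N) x w U ∂μ < 1 := by
  haveI : SecondCountableTopology (Matrix (Fin N) (Fin N) ℂ) := inferInstanceAs (SecondCountableTopology (Fin N → Fin N → ℂ))
  haveI : SecondCountableTopology (SU N) := Topology.IsEmbedding.subtypeVal.secondCountableTopology
  have hG : IsGibbsMeasure (ymSpecification (suRep N) β) μ := hμ
  haveI := hG.isProbabilityMeasure
  exact (isHaarShiftState_of_mem_ymGibbsMeasures (suRep N) (continuous_suRep N) hμ).integral_wordLoopZd_lt_one hN x hw

/-- ★★★ **Every thermodynamic limit point of the torus Wilson states** (`SU(N)`, `N ≥ 2`, any `d`, any `β`):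
`∫ W_x(w) dμ < 1` for every word with non-empty free reduction. [folklore] -/
theorem integral_wordLoopZd_lt_one_of_mem_infiniteVolumeLimitPoints (hN : 2 ≤ N) {β : ℝ} {μ : Measure (LGConfig d (SU N))}
    (hμ : μ ∈ infiniteVolumeLimitPoints (d := d) (suRep N) β) (x : Site d) {w : Word d} (hw : Word.freeReduce w ≠ []) :
    ∫ U, wordLoopZd (suRep N) x w U ∂μ < 1 := by
  haveI : SecondCountableTopology (Matrix (Fin N) (Fin N) ℂ) := inferInstanceAs (SecondCountableTopology (Fin N → Fin N → ℂ))
  haveI : SecondCountableTopology (SU N) := Topology.IsEmbedding.subtypeVal.secondCountableTopology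
  haveI : IsProbabilityMeasure μ := by obtain ⟨L, -, hL⟩ := hμ; exact hL.1
  exact (isHaarShiftState_of_mem_infiniteVolumeLimitPoints (suRep N) (continuous_suRep N) hμ).integral_wordLoopZd_lt_one hN x hw

/-- At a thermodynamic limit point, `∫ W_x(w) dμ = 1` iff the word freely reduces to nothing. [folklore] -/
theorem integral_wordLoopZd_eq_one_iff_of_mem_infiniteVolumeLimitPoints (hN : 2 ≤ N) {β : ℝ} {μ : Measure (LGConfig d (SU N))}
    (hμ : μ ∈ infiniteVolumeLimitPoints (d := d) (suRep N) β) (x : Site d) (w : Word d) :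
    ∫ U, wordLoopZd (suRep N) x w U ∂μ = 1 ↔ Word.freeReduce w = [] := by
  haveI : SecondCountableTopology (Matrix (Fin N) (Fin N) ℂ) := inferInstanceAs (SecondCountableTopology (Fin N → Fin N → ℂ))
  haveI : SecondCountableTopology (SU N) := Topology.IsEmbedding.subtypeVal.secondCountableTopology
  haveI : IsProbabilityMeasure μ := by obtain ⟨L, -, hL⟩ := hμ; exact hL.1
  exact (isHaarShiftState_of_mem_infiniteVolumeLimitPoints (suRep N) (continuous_suRep N) hμ).integral_wordLoopZd_eq_one_iff hN x w

/-- ★★★ **Every Class-B state** (`SU(N)`, `N ≥ 2`, any `d`, any `β`): `∫ W_x(w) dω < 1` for every word with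
non-empty free reduction — the a-priori bound `y_v ≤ 1` of a Class-B certificate is never attained by a state
on a non-trivial loop variable. [folklore] -/
theorem ClassBState.integral_wordLoopZd_lt_one (hN : 2 ≤ N) {β : ℝ} (ω : ClassBState (d := d) (suRep N) β) (x : Site d) {w : Word d}
    (hw : Word.freeReduce w ≠ []) : ∫ U, wordLoopZd (suRep N) x w U ∂ω.μ < 1 := by
  haveI := ω.isProbabilityMeasure
  exact ω.haarShift.integral_wordLoopZd_lt_one hN x hw

/-- Class-B: `∫ W_x(w) dω = 1` iff the word freely reduces to nothing. [folklore] -/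
theorem ClassBState.integral_wordLoopZd_eq_one_iff (hN : 2 ≤ N) {β : ℝ} (ω : ClassBState (d := d) (suRep N) β) (x : Site d) (w : Word d) :
    ∫ U, wordLoopZd (suRep N) x w U ∂ω.μ = 1 ↔ Word.freeReduce w = [] := by
  haveI := ω.isProbabilityMeasure
  exact ω.haarShift.integral_wordLoopZd_eq_one_iff hN x w

/-- Class-B: `|∫ W_x(w) dω| < 1` for every word with non-empty free reduction. [folklore] -/
theorem ClassBState.abs_integral_wordLoopZd_lt_one (hN : 2 ≤ N) {β : ℝ} (ω : ClassBState (d := d) (suRep N) β) (x : Site d) {w : Word d}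
    (hw : Word.freeReduce w ≠ []) : |∫ U, wordLoopZd (suRep N) x w U ∂ω.μ| < 1 := by
  haveI := ω.isProbabilityMeasure
  exact ω.haarShift.abs_integral_wordLoopZd_lt_one hN x hw

/-- **In particular the plaquette**: `∫ W_x(plaquette i j) dω < 1` in every Class-B state (`i ≠ j`). [folklore] -/
theorem ClassBState.integral_wordLoopZd_plaquette_lt_one (hN : 2 ≤ N) {β : ℝ} (ω : ClassBState (d := d) (suRep N) β) (x : Site d)
    {i j : Fin d} (hij : i ≠ j) : ∫ U, wordLoopZd (suRep N) x (Word.plaquette i j) U ∂ω.μ < 1 := by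
  refine ω.integral_wordLoopZd_lt_one hN x ?_
  rw [Word.freeReduce_eq_self_of_isChain]
  · simp [Word.plaquette]
  · simp [Word.plaquette, Step.inv, hij]

end Summit.QuantumFields.GaugeBoot

end
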